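import Summits.QuantumFields.YangMills.Theorems.BalabanUVNodesN16OfEdgesAllTorusAtRecord13CoPH
import Summits.QuantumFields.YangMills.Theorems.BalabanUVNodesN16HolderMSOfSocketsAllTorusPinned
import Summits.QuantumFields.YangMills.Theorems.BalabanUVNodesN16OfSocketsAllTorusPinned

/-!
# Route «BalabanUVNodes», cluster K4 «SpineRates» — node N16 = NE3 AT dag-n22-e's NAMED STAGE-13 READING OF RECORD `readingOfRecord₁₃CoPH w1 ℓ₃ ne2 ne1` FROM
# NODE N05's FIVE SOCKETS AT THE PINNED ALL-TORUS MEMBERS (⊂ `IdxB8SubB`) AND N07's LINEAR LEAF, LETTERS CHOSEN — the SOCKET-CURRENCY twin of module 37ᴴ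
# `…N16OfEdgesAllTorusAtRecord13CoPH` (p545649)

Cell `pub-ymgap`, seat `pub-ymgap-dag-n16-e` (R134 acceleration seat (a), strategy s2 = BY-NAME KNIT at the record; HUMAN RULING D-0062; chair R424 venue), generation 13,
module 38ᴴ (THEOREMS ONLY, 0 `def`, 0 `sorry`, standard axioms).  `--kind proof --supports stmt-QuantumFields-20544 --as helper` (K3⁷ `SpineGivenEndpointR13SepCoPH`, plan rev 24∕25,
dag-lead WORDS-143).  `bears_on: R4∕N16 · edges N05 → N16, N07 → N16 · out-edge N16 → N21`.  Over module 37ᴴ (this seat, g8: N16 at the reading of record from its two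
in-edges with N05's conjuncts `B8.Thm4Body` ∕ `B8.Prop3Body` and the window read at the PINNED all-torus proper sub-index) and dag-n16-c's R-b″ files F47
`…N16OfSocketsAllTorusPinned` ∕ F48 `…N16HolderMSOfSocketsAllTorusPinned` (whose §4 derives exactly those conjuncts, per carrier, from n05-a's five sockets by n05-a's KERNEL
theorems `B8LeafKnitZd3E.thm4Printed_zd3_mapE` ([Balaban1985RegularSpaces] Thm 4 from Prop. 5 ∕ (1.59)-type sockets) and `B8LeafModelZd3Map.prop3Printed_zd3_map` (Prop. 3 from its
[Balaban1985Averaging]-input socket) and dag-n16-c's window lemma `N16.OfLeaf.exists_window_print`).  Restates nothing: F47∕F48's socket blocks are CITED per family, 37ᴴ's six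
theorems are APPLIED.

WHAT THIS FILE PROVES (kernel bookkeeping by name; no estimate).
* §0 (stage-free, edition-free, per carrier `L ≥ 2`, any exponent `β`, any length letter `len`) `leafLettersAT_of_socketsPinned`: n05-a's sockets `SockP5base ∕ SockP5 ∕ SockH59 ∕
  SockP5uE ∕ SockB9P3` at the pinned all-torus members of `zdGF3 (M_N ℂ) L β len` with letters `C₂ B₀ B₀′ cu cP inp B₀β` give letters `c₁ c₁′ B₁′ cP′` with
  `0 < B₁′ ∧ 5·4·L·inp.B₀ ≤ B₁′ ∧ 0 < c₁′ ∧ (window) ∧ B8.Thm4Body c₁ B₁′ (…) ∧ B8.Prop3Body cP′ 4 L C₂ inp B₀β (…)` — the body of 37ᴴ's hypothesis `h5` at one family;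
  `leafLettersAT_of_socketsHFP₄Pinned`: the same in n05-a's HFP₄ socket currency (`SockHFP₀ ∕ SockHFP ∕ SockH59 ∕ SockP5uE` with separate thresholds, `thm4Printed_zd3_of_HFP₄_mapE`).
* §1 (β = 1, the stub of record) ★ `exists_letters_s_N16_readingOfRecord₁₃CoPHOn_of_sockets_allTorus` ∕ `exists_letters_s_N16_readingOfRecord₁₃CoPH_of_sockets_allTorus`,
  §2 (R-β) `exists_letters_s_N16Holder_readingOfRecord₁₃CoPHOn_of_sockets_allTorus`, §3 (R-β″) `exists_letters_s_N16HolderMS_readingOfRecord₁₃CoPHOn_of_sockets_allTorus`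
  = 37ᴴ's `…_of_edges_allTorus` theorems with the N05 hypothesis `h5` REPLACED by `hS : ∀ F, ∃ len C₂ B₀ B₀′ cu cP B₀β inp, (len lines) ∧ (side letters) ∧ (the five sockets at
  the pinned members of zdGF3 (M_N ℂ) F.L β len)` and EVERY OTHER hypothesis and the WHOLE conclusion VERBATIM (proof = 37ᴴ ∘ §0).

WHY (HOME `HANDOFF.md` §g9 «DOOR SEEN, NOT TYPED», g10 (D2)).  The five sockets at the pinned members are the typed N05∕N06 interface BELOW n05-a's kernel Theorem 4 ∕
Proposition 3 — the face through which 37ᴴ's `h5` is discharged on the F47 road (dag-n06-b's `sock…_univ_explicit_on`, dag-n05-d's T1 p551339, dag-n05-e's uniform thresholds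
work at that interface); after this file the K3⁷ reading's N16 slot (`h16` = 37ᴴ's first conjunct, dag-n27-c :151 ∕ K3⁷ Homes :68) displays only SOCKET hypotheses at members
obeying node N05's four index laws (F47 §1 `idxB8LawsB_allTorusPinned`) and N07's `LeafH3sup`.

HONEST FRAMING.  Kernel bookkeeping by name; no estimate; the five sockets ([Balaban1985RegularSpaces] Prop. 5 (1.106)–(1.109) p.94, (1.59) p.86 ∕ [Balaban1985Averaging]
(H.59), Thm 3.3-type) are HYPOTHESES asserted for no family — node N05's ∕ N06's open obligations; N07's linear `LeafH3sup` ([Balaban1985Variational] Thm 1 (8)+(10) TYPE) is a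
HYPOTHESIS; `w1` ∕ `ne2` ∕ `ne1` are residual DATA; no admissible Stage-13 tuple of this edition is claimed to exist (K0⁷ OPEN); the (42)∕(0.4) averaging transfer (N21's
`hdict`) and the Hölder-pin ruling untouched; nothing of Bałaban's asserted; **N16 ∕ NE3 is NOT discharged**; count-neutral (typed 28∕28 · discharged 5∕27, A 5∕28 UNMOVED);
one finite four-torus at fixed ε — NOT ℝ⁴, NOT infinite volume, NOT OS, NOT a mass gap, NOT Clay.
-/

set_option autoImplicit false

open scoped BigOperators Matrix Matrix.Norms.L2Operator
open NormedSpace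

namespace Summit.QuantumFields.YangMills.BalabanUVNodes.N16OfSocketsAllTorusAtRecord13CoPH

open Literature.MathematicalPhysics.QuantumFieldTheory.Balaban1983to89
open Literature.MathematicalPhysics.QuantumFieldTheory.Balaban1983to89.T4Continuum (T4Family ULoop)
open B7Prop1Explicit B7Prop2Explicit
open B7Prop3Flat (c3)
open B8LeafModelZd (ZdIdx SockP5base SockP5 SockH59)
open B8LeafModelZd3 (zdGF3 SockB9P3)
open B8LeafModelZdSockP5uE (SockP5uE)
open B8LeafModelZdOfHFP (SockHFP₀ SockHFP)
open Node00 (Stage13HParams NE3Objects₁₁ NE3Letters₁₁ NE2Objects₁₁ ne3ConstLayerOfRecord₁₁ ne3NperOfRecord₁₁ ne3DomOfRecord₁₁ MatA)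
open Node00.W1 (ReadingData)
open Summit.QuantumFields.BalabanUV.T4Continuum
open NE3.LeafIndexSockets (LeafH3sup)
open YMDAG.UVSplit (Datum NE3Carriers NE1pCarriers S_N16 ne3OfRecord₁₁ RRec₁₃CoPH RRec₁₃CoPHOn readingOfRecord₁₃CoPH readingOfRecord₁₃CoPH_ne3)
open Summit.QuantumFields.YangMills.BalabanUVNodes.N16Regime (InEndRegime radiusOfRecord constOfRecord)
open Summit.QuantumFields.YangMills.BalabanUVNodes.N16HolderDefs (S_N16Holder)
open Summit.QuantumFields.YangMills.BalabanUVNodes.N16HolderMSDefs (S_N16HolderMS)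
open Summit.QuantumFields.YangMills.BalabanUVNodes.N16HolderRegime (InEndRegimeH radiusOfRecordH constOfRecordH)
open Summit.QuantumFields.YangMills.BalabanUVNodes.N16HolderMSRegime (InEndRegimeHMS radiusOfRecordHMS constOfRecordHMS)
open Summit.QuantumFields.YangMills.BalabanUVNodes.N16LeafSlotAllTorus (LeafSlotAT LeafSlotHolderAT LeafSlotHolderMSAT)
open Summit.QuantumFields.YangMills.BalabanUVNodes.N16.OfLeaf (exists_window_print)
open Summit.QuantumFields.YangMills.BalabanUVNodes.N16OfEdgesAllTorusAtRecord13CoPH (exists_letters_s_N16_readingOfRecord₁₃CoPHOn_of_edges_allTorus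
  exists_letters_s_N16_readingOfRecord₁₃CoPH_of_edges_allTorus exists_letters_s_N16Holder_readingOfRecord₁₃CoPHOn_of_edges_allTorus
  exists_letters_s_N16HolderMS_readingOfRecord₁₃CoPHOn_of_edges_allTorus)

noncomputable section

variable {N : ℕ} [NeZero N]

/-! ## §0 Stage-free, per carrier: node N05's five sockets at the pinned all-torus members give the AT leaf letters (`Thm4Body`, `Prop3Body`, window) -/

/-- **THE AT LEAF LETTERS OF ONE CARRIER FROM NODE N05's FIVE SOCKETS AT THE PINNED ALL-TORUS MEMBERS** (`d = 4`, `L ≥ 2`, colour algebra `M_N(ℂ)`, any exponent `β`, any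
length letter `len`): n05-a's sockets `SockP5base ∕ SockP5 ∕ SockH59 ∕ SockP5uE ∕ SockB9P3` at the members `(η = (Lᵏ)⁻¹, k, Ω ≡ ℤ⁴, Λs m j = {j = m}, Λb m j = {j = m})` of
`zdGF3 (M_N ℂ) L β len` with letters `C₂ B₀ B₀′ cu cP inp B₀β` give `c₁ c₁′ cP′` and `B₁′ := 5·4·L·B₀` with the window below the printed thresholds and node N05's two conjuncts —
dag-n16-c F47∕F48 §4's first proof lines BY NAME (`thm4Printed_zd3_mapE`, `prop3Printed_zd3_map`, `exists_window_print`); the body of module 37ᴴ's per-family hypothesis `h5`.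
Nothing of Bałaban is proved: the sockets are node N05's ∕ N06's open obligations. [cite: Balaban1985RegularSpaces, Thm 4 p.88, Prop. 3 p.87, Prop. 5 p.94, (1.59) p.86, p.77] [folklore] -/
theorem leafLettersAT_of_socketsPinned {L : ℕ} (hL : 2 ≤ L) (β : ℝ) (len : Site 4 → ℝ) {C₂ B₀ B₀' cu cP B₀β : ℝ} (inp : B8.B9Inputs)
    (hB₀ : 0 < B₀) (hiB : inp.B₀ ≤ B₀) (hB₀' : 0 < B₀') (hB : 2 ≤ 5 * ((4 : ℕ) : ℝ) * L * B₀) (hcu : 0 < cu) (hcP : 0 < cP) (hB₀β : 0 ≤ B₀β)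
    (hC₂ : 2097152 * (((4 : ℕ) : ℝ) + 1) ^ 2 ≤ C₂) :
    letI : CStarAlgebra (Matrix (Fin N) (Fin N) ℂ) := {}
    (∀ i : {i : ZdIdx 4 L // (∀ j, i.Ω j = Set.univ) ∧ (∀ m j, i.Λs m j = {_y | j = m}) ∧ (∀ m j, i.Λb m j = {_c | j = m}) ∧ i.η = ((L : ℝ)⁻¹) ^ i.k}, SockP5base (𝔸 := Matrix (Fin N) (Fin N) ℂ) L B₀ B₀' cP i.1.η i.1.k i.1.Ω i.1.Λs) →
    (∀ i : {i : ZdIdx 4 L // (∀ j, i.Ω j = Set.univ) ∧ (∀ m j, i.Λs m j = {_y | j = m}) ∧ (∀ m j, i.Λb m j = {_c | j = m}) ∧ i.η = ((L : ℝ)⁻¹) ^ i.k}, SockP5 (𝔸 := Matrix (Fin N) (Fin N) ℂ) L B₀ B₀' cP i.1.η i.1.k i.1.Ω i.1.Λs) →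
    (∀ i : {i : ZdIdx 4 L // (∀ j, i.Ω j = Set.univ) ∧ (∀ m j, i.Λs m j = {_y | j = m}) ∧ (∀ m j, i.Λb m j = {_c | j = m}) ∧ i.η = ((L : ℝ)⁻¹) ^ i.k}, SockH59 (𝔸 := Matrix (Fin N) (Fin N) ℂ) L B₀ B₀' cP i.1.η i.1.k i.1.Ω i.1.Λs i.1.Λb) →
    (∀ i : {i : ZdIdx 4 L // (∀ j, i.Ω j = Set.univ) ∧ (∀ m j, i.Λs m j = {_y | j = m}) ∧ (∀ m j, i.Λb m j = {_c | j = m}) ∧ i.η = ((L : ℝ)⁻¹) ^ i.k}, SockP5uE (𝔸 := Matrix (Fin N) (Fin N) ℂ) L B₀ cP cu i.1.η i.1.k i.1.Ω i.1.Λs) →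
    (∀ i : {i : ZdIdx 4 L // (∀ j, i.Ω j = Set.univ) ∧ (∀ m j, i.Λs m j = {_y | j = m}) ∧ (∀ m j, i.Λb m j = {_c | j = m}) ∧ i.η = ((L : ℝ)⁻¹) ^ i.k}, SockB9P3 (𝔸 := Matrix (Fin N) (Fin N) ℂ) L inp.B₀ B₀β cP β len i.1.η i.1.k i.1.Ω i.1.Λs i.1.Λb) →
    ∃ c₁ c₁' B₁' cP' : ℝ, 0 < B₁' ∧ 5 * ((4 : ℕ) : ℝ) * L * inp.B₀ ≤ B₁' ∧ 0 < c₁' ∧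
      (∀ α₀ α₁ : ℝ, 0 < α₀ → 0 < α₁ → α₀ + α₁ ≤ c₁' →
        α₀ + α₁ ≤ c₁ ∧ C0 4 * (2 * α₀) ≤ 1 / 3 ∧ 4 * α₀ ≤ c2' 4 L ∧ 16 * (B₁' * (α₀ + α₁)) ≤ 1 ∧
        Real.exp (4 * (800 * (((4 : ℕ) : ℝ) + 1) ^ 2 * (((4 : ℕ) : ℝ) + 4)) * α₀) * (1 + 8 * (131072 * (((4 : ℕ) : ℝ) + 1) ^ 2) * (B₁' * (α₀ + α₁))) ≤ 2 ∧
        2 * (B₁' * (α₀ + α₁)) ≤ c3 4 L ∧ ((4 : ℕ) : ℝ) * L * α₁ ≤ 1 / 8 ∧ α₀ ≤ cP' ∧ α₁ ≤ cP' ∧ B₁' * (α₀ + α₁) ≤ cP' ∧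
        2 * (B₁' * (α₀ + α₁)) ^ 2 + 20 * ((4 : ℕ) : ℝ) * α₀ * (B₁' * (α₀ + α₁)) + 2 * C₂ * (B₁' * (α₀ + α₁)) ^ 2 ≤ α₀ + α₁) ∧
      B8.Thm4Body c₁ B₁' (fun i : {i : ZdIdx 4 L // (∀ j, i.Ω j = Set.univ) ∧ (∀ m j, i.Λs m j = {_y | j = m}) ∧ (∀ m j, i.Λb m j = {_c | j = m}) ∧ i.η = ((L : ℝ)⁻¹) ^ i.k} => (zdGF3 (Matrix (Fin N) (Fin N) ℂ) L β len i.1).toGFData) ∧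
      B8.Prop3Body cP' 4 (L : ℝ) C₂ inp B₀β (fun i : {i : ZdIdx 4 L // (∀ j, i.Ω j = Set.univ) ∧ (∀ m j, i.Λs m j = {_y | j = m}) ∧ (∀ m j, i.Λb m j = {_c | j = m}) ∧ i.η = ((L : ℝ)⁻¹) ^ i.k} => (zdGF3 (Matrix (Fin N) (Fin N) ℂ) L β len i.1).toGFData2) := by
  letI : CStarAlgebra (Matrix (Fin N) (Fin N) ℂ) := {}
  intro SP5base SP5 SH59 SP5u SB9
  -- node N05's Theorem 4 ∕ Proposition 3 on the PINNED all-torus sub-family from the sockets there (n05-a, `ι := Subtype.val`)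
  obtain ⟨c₁, hc₁, hT⟩ := B8LeafKnitZd3E.thm4Printed_zd3_mapE (𝔸 := Matrix (Fin N) (Fin N) ℂ) (d := 4) (by norm_num) hL (β := β)
    (len := len) hB₀ hB₀' hB hcu hcP (fun i : {i : ZdIdx 4 L // (∀ j, i.Ω j = Set.univ) ∧ (∀ m j, i.Λs m j = {_y | j = m}) ∧ (∀ m j, i.Λb m j = {_c | j = m}) ∧ i.η = ((L : ℝ)⁻¹) ^ i.k} => i.1) SP5base SP5 SH59 SP5u
  obtain ⟨cP', hcP', hP⟩ := B8LeafModelZd3Map.prop3Printed_zd3_map (𝔸 := Matrix (Fin N) (Fin N) ℂ) (d := 4) (by norm_num) hL inp hB₀β hC₂ hcP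
    β len (fun i : {i : ZdIdx 4 L // (∀ j, i.Ω j = Set.univ) ∧ (∀ m j, i.Λs m j = {_y | j = m}) ∧ (∀ m j, i.Λb m j = {_c | j = m}) ∧ i.η = ((L : ℝ)⁻¹) ^ i.k} => i.1) SB9
  -- the letter `B₁′ := 5·4·L·B₀` and the window threshold below the two printed thresholds (dag-n16-c's `exists_window_print`)
  have hLpos : (0 : ℝ) < L := by exact_mod_cast (show 0 < L by omega)
  have hB₁' : 0 < 5 * ((4 : ℕ) : ℝ) * L * B₀ := by positivity
  have hBB : 5 * ((4 : ℕ) : ℝ) * L * inp.B₀ ≤ 5 * ((4 : ℕ) : ℝ) * L * B₀ := mul_le_mul_of_nonneg_left hiB (by positivity)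
  obtain ⟨c₁', hc₁', hwin⟩ := exists_window_print (d := 4) (L := L) (by norm_num) hL C₂ hc₁ hcP' hB₁'
  exact ⟨c₁, c₁', 5 * ((4 : ℕ) : ℝ) * L * B₀, cP', hB₁', hBB, hc₁', hwin, hT, hP⟩

/-- **THE SAME IN n05-a's HFP₄ SOCKET CURRENCY** (the two Proposition-5 existence sockets in plain fixed-point form `SockHFP₀ ∕ SockHFP`, each of the four Theorem-4 sockets with
its own threshold `cF₀ ∕ cF ∕ c59 ∕ cu′`; Proposition 3's socket `SockB9P3` at `cP`): dag-n16-c F48 §4's HFP₄ proof lines BY NAME (`thm4Printed_zd3_of_HFP₄_mapE`,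
`prop3Printed_zd3_map`, `exists_window_print`).  Nothing of Bałaban is proved. [cite: Balaban1985RegularSpaces, Thm 4 p.88, Prop. 3 p.87, Prop. 5 (1.106)–(1.109) p.94, (1.59) p.86] [folklore] -/
theorem leafLettersAT_of_socketsHFP₄Pinned {L : ℕ} (hL : 2 ≤ L) (β : ℝ) (len : Site 4 → ℝ) {C₂ B₀ B₀' cu cF₀ cF c59 cu' cP B₀β : ℝ} (inp : B8.B9Inputs)
    (hB₀ : 0 < B₀) (hiB : inp.B₀ ≤ B₀) (hB₀' : 0 < B₀') (hB : 2 ≤ 5 * ((4 : ℕ) : ℝ) * L * B₀) (hcu : 0 < cu) (hcF₀ : 0 < cF₀) (hcF : 0 < cF) (hc59 : 0 < c59)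
    (hcu' : 0 < cu') (hcP : 0 < cP) (hB₀β : 0 ≤ B₀β) (hC₂ : 2097152 * (((4 : ℕ) : ℝ) + 1) ^ 2 ≤ C₂) :
    letI : CStarAlgebra (Matrix (Fin N) (Fin N) ℂ) := {}
    (∀ i : {i : ZdIdx 4 L // (∀ j, i.Ω j = Set.univ) ∧ (∀ m j, i.Λs m j = {_y | j = m}) ∧ (∀ m j, i.Λb m j = {_c | j = m}) ∧ i.η = ((L : ℝ)⁻¹) ^ i.k}, SockHFP₀ (𝔸 := Matrix (Fin N) (Fin N) ℂ) L B₀ B₀' cF₀ i.1.η i.1.k i.1.Ω i.1.Λs) →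
    (∀ i : {i : ZdIdx 4 L // (∀ j, i.Ω j = Set.univ) ∧ (∀ m j, i.Λs m j = {_y | j = m}) ∧ (∀ m j, i.Λb m j = {_c | j = m}) ∧ i.η = ((L : ℝ)⁻¹) ^ i.k}, SockHFP (𝔸 := Matrix (Fin N) (Fin N) ℂ) L B₀ B₀' cF i.1.η i.1.k i.1.Ω i.1.Λs) →
    (∀ i : {i : ZdIdx 4 L // (∀ j, i.Ω j = Set.univ) ∧ (∀ m j, i.Λs m j = {_y | j = m}) ∧ (∀ m j, i.Λb m j = {_c | j = m}) ∧ i.η = ((L : ℝ)⁻¹) ^ i.k}, SockH59 (𝔸 := Matrix (Fin N) (Fin N) ℂ) L B₀ B₀' c59 i.1.η i.1.k i.1.Ω i.1.Λs i.1.Λb) →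
    (∀ i : {i : ZdIdx 4 L // (∀ j, i.Ω j = Set.univ) ∧ (∀ m j, i.Λs m j = {_y | j = m}) ∧ (∀ m j, i.Λb m j = {_c | j = m}) ∧ i.η = ((L : ℝ)⁻¹) ^ i.k}, SockP5uE (𝔸 := Matrix (Fin N) (Fin N) ℂ) L B₀ cu' cu i.1.η i.1.k i.1.Ω i.1.Λs) →
    (∀ i : {i : ZdIdx 4 L // (∀ j, i.Ω j = Set.univ) ∧ (∀ m j, i.Λs m j = {_y | j = m}) ∧ (∀ m j, i.Λb m j = {_c | j = m}) ∧ i.η = ((L : ℝ)⁻¹) ^ i.k}, SockB9P3 (𝔸 := Matrix (Fin N) (Fin N) ℂ) L inp.B₀ B₀β cP β len i.1.η i.1.k i.1.Ω i.1.Λs i.1.Λb) →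
    ∃ c₁ c₁' B₁' cP' : ℝ, 0 < B₁' ∧ 5 * ((4 : ℕ) : ℝ) * L * inp.B₀ ≤ B₁' ∧ 0 < c₁' ∧
      (∀ α₀ α₁ : ℝ, 0 < α₀ → 0 < α₁ → α₀ + α₁ ≤ c₁' →
        α₀ + α₁ ≤ c₁ ∧ C0 4 * (2 * α₀) ≤ 1 / 3 ∧ 4 * α₀ ≤ c2' 4 L ∧ 16 * (B₁' * (α₀ + α₁)) ≤ 1 ∧
        Real.exp (4 * (800 * (((4 : ℕ) : ℝ) + 1) ^ 2 * (((4 : ℕ) : ℝ) + 4)) * α₀) * (1 + 8 * (131072 * (((4 : ℕ) : ℝ) + 1) ^ 2) * (B₁' * (α₀ + α₁))) ≤ 2 ∧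
        2 * (B₁' * (α₀ + α₁)) ≤ c3 4 L ∧ ((4 : ℕ) : ℝ) * L * α₁ ≤ 1 / 8 ∧ α₀ ≤ cP' ∧ α₁ ≤ cP' ∧ B₁' * (α₀ + α₁) ≤ cP' ∧
        2 * (B₁' * (α₀ + α₁)) ^ 2 + 20 * ((4 : ℕ) : ℝ) * α₀ * (B₁' * (α₀ + α₁)) + 2 * C₂ * (B₁' * (α₀ + α₁)) ^ 2 ≤ α₀ + α₁) ∧
      B8.Thm4Body c₁ B₁' (fun i : {i : ZdIdx 4 L // (∀ j, i.Ω j = Set.univ) ∧ (∀ m j, i.Λs m j = {_y | j = m}) ∧ (∀ m j, i.Λb m j = {_c | j = m}) ∧ i.η = ((L : ℝ)⁻¹) ^ i.k} => (zdGF3 (Matrix (Fin N) (Fin N) ℂ) L β len i.1).toGFData) ∧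
      B8.Prop3Body cP' 4 (L : ℝ) C₂ inp B₀β (fun i : {i : ZdIdx 4 L // (∀ j, i.Ω j = Set.univ) ∧ (∀ m j, i.Λs m j = {_y | j = m}) ∧ (∀ m j, i.Λb m j = {_c | j = m}) ∧ i.η = ((L : ℝ)⁻¹) ^ i.k} => (zdGF3 (Matrix (Fin N) (Fin N) ℂ) L β len i.1).toGFData2) := by
  letI : CStarAlgebra (Matrix (Fin N) (Fin N) ℂ) := {}
  intro SHFP₀ SHFP SH59 SP5u SB9
  obtain ⟨c₁, hc₁, hT⟩ := B8LeafKnitZd3E.thm4Printed_zd3_of_HFP₄_mapE (𝔸 := Matrix (Fin N) (Fin N) ℂ) (d := 4) (by norm_num) hL (β := β)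
    (len := len) hB₀ hB₀' hB hcu hcF₀ hcF hc59 hcu' (fun i : {i : ZdIdx 4 L // (∀ j, i.Ω j = Set.univ) ∧ (∀ m j, i.Λs m j = {_y | j = m}) ∧ (∀ m j, i.Λb m j = {_c | j = m}) ∧ i.η = ((L : ℝ)⁻¹) ^ i.k} => i.1) SHFP₀ SHFP SH59 SP5u
  obtain ⟨cP', hcP', hP⟩ := B8LeafModelZd3Map.prop3Printed_zd3_map (𝔸 := Matrix (Fin N) (Fin N) ℂ) (d := 4) (by norm_num) hL inp hB₀β hC₂ hcP
    β len (fun i : {i : ZdIdx 4 L // (∀ j, i.Ω j = Set.univ) ∧ (∀ m j, i.Λs m j = {_y | j = m}) ∧ (∀ m j, i.Λb m j = {_c | j = m}) ∧ i.η = ((L : ℝ)⁻¹) ^ i.k} => i.1) SB9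
  have hLpos : (0 : ℝ) < L := by exact_mod_cast (show 0 < L by omega)
  have hB₁' : 0 < 5 * ((4 : ℕ) : ℝ) * L * B₀ := by positivity
  have hBB : 5 * ((4 : ℕ) : ℝ) * L * inp.B₀ ≤ 5 * ((4 : ℕ) : ℝ) * L * B₀ := mul_le_mul_of_nonneg_left hiB (by positivity)
  obtain ⟨c₁', hc₁', hwin⟩ := exists_window_print (d := 4) (L := L) (by norm_num) hL C₂ hc₁ hcP' hB₁'
  exact ⟨c₁, c₁', 5 * ((4 : ℕ) : ℝ) * L * B₀, cP', hB₁', hBB, hc₁', hwin, hT, hP⟩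

/-! ## §1 β = 1, the stub of record `S_N16` at the reading of record, from the five sockets and N07's linear leaf -/

section One

variable (Rg : (F : T4Family) → Stage13HParams F N → Prop)
  (w1 : (F : T4Family) → (θ : Stage13HParams F N) → ReadingData F (MatA N) θ.τ9.M)
  (ne2 : (F : T4Family) → Stage13HParams F N → (ℕ → ℝ) → List (ULoop F) → ℕ → NE2Objects₁₁)
  (ne1 : (F : T4Family) → Stage13HParams F N → (ℕ → ℝ) → List (ULoop F) → NE1pCarriers)

/-- ★ **N16 AT THE REGIME-RESTRICTED READING OF RECORD FROM NODE N05's FIVE SOCKETS AT THE PINNED ALL-TORUS MEMBERS AND N07's LINEAR LEAF, LETTERS CHOSEN** (β = 1): per family,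
n05-a's five sockets at the pinned members of `zdGF3 (M_N ℂ) F.L 1 len` with their letters and side conditions (hypothesis `hS`), N07's linear leaf (`h7`) and a coupling letter
`g F > 0` give letters of record `ℓ₃` with the K3⁷ composer's `h16 : S_N16 (RRec₁₃CoPHOn (readingOfRecord₁₃CoPH w1 ℓ₃ ne2 ne1) Rg)` AND, at every family, THE END's proviso,
`LeafSlotAT` and dag-n21-d's numerals — module 37ᴴ's `exists_letters_s_N16_readingOfRecord₁₃CoPHOn_of_edges_allTorus` with its `h5` supplied by §0; `Rg`, `w1`, `ne2`, `ne1` free.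
The sockets and `LeafH3sup` are HYPOTHESES; N16 ∕ NE3 NOT discharged. [folklore] -/
theorem exists_letters_s_N16_readingOfRecord₁₃CoPHOn_of_sockets_allTorus {g : T4Family → ℝ} (hg : ∀ F, 0 < g F)
    (hS : ∀ F : T4Family, letI : CStarAlgebra (Matrix (Fin N) (Fin N) ℂ) := {}
      ∃ (len : Site 4 → ℝ) (C₂ B₀ B₀' cu cP B₀β : ℝ) (inp : B8.B9Inputs),
        (∀ v : Site 4, 0 < len v → 1 ≤ len v) ∧ (∀ μ : Fin 4, len (e μ) = 1) ∧
        0 < B₀ ∧ inp.B₀ ≤ B₀ ∧ 0 < B₀' ∧ 2 ≤ 5 * ((4 : ℕ) : ℝ) * F.L * B₀ ∧ 0 < cu ∧ 0 < cP ∧ 0 ≤ B₀β ∧ 2097152 * (((4 : ℕ) : ℝ) + 1) ^ 2 ≤ C₂ ∧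
        (∀ i : {i : ZdIdx 4 F.L // (∀ j, i.Ω j = Set.univ) ∧ (∀ m j, i.Λs m j = {_y | j = m}) ∧ (∀ m j, i.Λb m j = {_c | j = m}) ∧ i.η = ((F.L : ℝ)⁻¹) ^ i.k}, SockP5base (𝔸 := Matrix (Fin N) (Fin N) ℂ) F.L B₀ B₀' cP i.1.η i.1.k i.1.Ω i.1.Λs) ∧
        (∀ i : {i : ZdIdx 4 F.L // (∀ j, i.Ω j = Set.univ) ∧ (∀ m j, i.Λs m j = {_y | j = m}) ∧ (∀ m j, i.Λb m j = {_c | j = m}) ∧ i.η = ((F.L : ℝ)⁻¹) ^ i.k}, SockP5 (𝔸 := Matrix (Fin N) (Fin N) ℂ) F.L B₀ B₀' cP i.1.η i.1.k i.1.Ω i.1.Λs) ∧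
        (∀ i : {i : ZdIdx 4 F.L // (∀ j, i.Ω j = Set.univ) ∧ (∀ m j, i.Λs m j = {_y | j = m}) ∧ (∀ m j, i.Λb m j = {_c | j = m}) ∧ i.η = ((F.L : ℝ)⁻¹) ^ i.k}, SockH59 (𝔸 := Matrix (Fin N) (Fin N) ℂ) F.L B₀ B₀' cP i.1.η i.1.k i.1.Ω i.1.Λs i.1.Λb) ∧
        (∀ i : {i : ZdIdx 4 F.L // (∀ j, i.Ω j = Set.univ) ∧ (∀ m j, i.Λs m j = {_y | j = m}) ∧ (∀ m j, i.Λb m j = {_c | j = m}) ∧ i.η = ((F.L : ℝ)⁻¹) ^ i.k}, SockP5uE (𝔸 := Matrix (Fin N) (Fin N) ℂ) F.L B₀ cP cu i.1.η i.1.k i.1.Ω i.1.Λs) ∧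
        (∀ i : {i : ZdIdx 4 F.L // (∀ j, i.Ω j = Set.univ) ∧ (∀ m j, i.Λs m j = {_y | j = m}) ∧ (∀ m j, i.Λb m j = {_c | j = m}) ∧ i.η = ((F.L : ℝ)⁻¹) ^ i.k}, SockB9P3 (𝔸 := Matrix (Fin N) (Fin N) ℂ) F.L inp.B₀ B₀β cP 1 len i.1.η i.1.k i.1.Ω i.1.Λs i.1.Λb))
    (h7 : ∀ F : T4Family, ∃ C ε₀ : ℝ, 0 ≤ C ∧ 0 < ε₀ ∧ ∀ ε : ℝ, 0 < ε → ε ≤ ε₀ →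
      LeafH3sup 4 F.L (ne3NperOfRecord₁₁ F 0 0) ε (C * ε) (C * ε) (ne3DomOfRecord₁₁ F N 0 0)) :
    ∃ ℓ₃ : T4Family → NE3Letters₁₁,
      S_N16 (RRec₁₃CoPHOn (readingOfRecord₁₃CoPH w1 ℓ₃ ne2 ne1) Rg) ∧
      ∀ F : T4Family, (ℓ₃ F).g = g F ∧ (ℓ₃ F).Λ₁ = radiusOfRecord N F.L (ne3NperOfRecord₁₁ F 0 0) ∧ (ℓ₃ F).C = constOfRecord N F.L (ne3NperOfRecord₁₁ F 0 0) (g F) ∧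
        0 < (ℓ₃ F).b ∧ 512 * (4 + 1) * (4 + 4) * (F.L : ℝ) ^ 2 * (ℓ₃ F).b ≤ 1 ∧ 0 < (ℓ₃ F).Λ₂' ∧
        InEndRegime (ne3OfRecord₁₁ F (ne3ConstLayerOfRecord₁₁ F N (ℓ₃ F))) ∧ LeafSlotAT (ne3OfRecord₁₁ F (ne3ConstLayerOfRecord₁₁ F N (ℓ₃ F))) := by
  refine exists_letters_s_N16_readingOfRecord₁₃CoPHOn_of_edges_allTorus (Rg := Rg) (w1 := w1) (ne2 := ne2) (ne1 := ne1) (hg := hg) (h7 := h7) (h5 := fun F => ?_)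
  obtain ⟨len, C₂, B₀, B₀', cu, cP, B₀β, inp, hlen, hlen1, hB₀, hiB, hB₀', hB, hcu, hcP, hB₀β, hC₂, SP5base, SP5, SH59, SP5u, SB9⟩ := hS F
  obtain ⟨c₁, c₁', B₁', cP', hB₁', hBB, hc₁', hwin, hT, hP⟩ :=
    leafLettersAT_of_socketsPinned (N := N) F.hL.2 1 len inp hB₀ hiB hB₀' hB hcu hcP hB₀β hC₂ SP5base SP5 SH59 SP5u SB9
  exact ⟨len, c₁, c₁', B₁', cP', C₂, B₀β, inp, hlen, hlen1, hB₁', hBB, hc₁', hwin, hT, hP⟩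

/-- **THE SAME AT THE CANONICAL READING OF RECORD** (`S_N16 (RRec₁₃CoPH (readingOfRecord₁₃CoPH w1 ℓ₃ ne2 ne1))`; module 37ᴴ's
`exists_letters_s_N16_readingOfRecord₁₃CoPH_of_edges_allTorus` with its `h5` supplied by §0). [folklore] -/
theorem exists_letters_s_N16_readingOfRecord₁₃CoPH_of_sockets_allTorus {g : T4Family → ℝ} (hg : ∀ F, 0 < g F)
    (hS : ∀ F : T4Family, letI : CStarAlgebra (Matrix (Fin N) (Fin N) ℂ) := {}
      ∃ (len : Site 4 → ℝ) (C₂ B₀ B₀' cu cP B₀β : ℝ) (inp : B8.B9Inputs),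
        (∀ v : Site 4, 0 < len v → 1 ≤ len v) ∧ (∀ μ : Fin 4, len (e μ) = 1) ∧
        0 < B₀ ∧ inp.B₀ ≤ B₀ ∧ 0 < B₀' ∧ 2 ≤ 5 * ((4 : ℕ) : ℝ) * F.L * B₀ ∧ 0 < cu ∧ 0 < cP ∧ 0 ≤ B₀β ∧ 2097152 * (((4 : ℕ) : ℝ) + 1) ^ 2 ≤ C₂ ∧
        (∀ i : {i : ZdIdx 4 F.L // (∀ j, i.Ω j = Set.univ) ∧ (∀ m j, i.Λs m j = {_y | j = m}) ∧ (∀ m j, i.Λb m j = {_c | j = m}) ∧ i.η = ((F.L : ℝ)⁻¹) ^ i.k}, SockP5base (𝔸 := Matrix (Fin N) (Fin N) ℂ) F.L B₀ B₀' cP i.1.η i.1.k i.1.Ω i.1.Λs) ∧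
        (∀ i : {i : ZdIdx 4 F.L // (∀ j, i.Ω j = Set.univ) ∧ (∀ m j, i.Λs m j = {_y | j = m}) ∧ (∀ m j, i.Λb m j = {_c | j = m}) ∧ i.η = ((F.L : ℝ)⁻¹) ^ i.k}, SockP5 (𝔸 := Matrix (Fin N) (Fin N) ℂ) F.L B₀ B₀' cP i.1.η i.1.k i.1.Ω i.1.Λs) ∧
        (∀ i : {i : ZdIdx 4 F.L // (∀ j, i.Ω j = Set.univ) ∧ (∀ m j, i.Λs m j = {_y | j = m}) ∧ (∀ m j, i.Λb m j = {_c | j = m}) ∧ i.η = ((F.L : ℝ)⁻¹) ^ i.k}, SockH59 (𝔸 := Matrix (Fin N) (Fin N) ℂ) F.L B₀ B₀' cP i.1.η i.1.k i.1.Ω i.1.Λs i.1.Λb) ∧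
        (∀ i : {i : ZdIdx 4 F.L // (∀ j, i.Ω j = Set.univ) ∧ (∀ m j, i.Λs m j = {_y | j = m}) ∧ (∀ m j, i.Λb m j = {_c | j = m}) ∧ i.η = ((F.L : ℝ)⁻¹) ^ i.k}, SockP5uE (𝔸 := Matrix (Fin N) (Fin N) ℂ) F.L B₀ cP cu i.1.η i.1.k i.1.Ω i.1.Λs) ∧
        (∀ i : {i : ZdIdx 4 F.L // (∀ j, i.Ω j = Set.univ) ∧ (∀ m j, i.Λs m j = {_y | j = m}) ∧ (∀ m j, i.Λb m j = {_c | j = m}) ∧ i.η = ((F.L : ℝ)⁻¹) ^ i.k}, SockB9P3 (𝔸 := Matrix (Fin N) (Fin N) ℂ) F.L inp.B₀ B₀β cP 1 len i.1.η i.1.k i.1.Ω i.1.Λs i.1.Λb))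
    (h7 : ∀ F : T4Family, ∃ C ε₀ : ℝ, 0 ≤ C ∧ 0 < ε₀ ∧ ∀ ε : ℝ, 0 < ε → ε ≤ ε₀ →
      LeafH3sup 4 F.L (ne3NperOfRecord₁₁ F 0 0) ε (C * ε) (C * ε) (ne3DomOfRecord₁₁ F N 0 0)) :
    ∃ ℓ₃ : T4Family → NE3Letters₁₁,
      S_N16 (RRec₁₃CoPH (readingOfRecord₁₃CoPH w1 ℓ₃ ne2 ne1)) ∧
      ∀ F : T4Family, (ℓ₃ F).g = g F ∧ (ℓ₃ F).Λ₁ = radiusOfRecord N F.L (ne3NperOfRecord₁₁ F 0 0) ∧ (ℓ₃ F).C = constOfRecord N F.L (ne3NperOfRecord₁₁ F 0 0) (g F) ∧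
        0 < (ℓ₃ F).b ∧ 512 * (4 + 1) * (4 + 4) * (F.L : ℝ) ^ 2 * (ℓ₃ F).b ≤ 1 ∧ 0 < (ℓ₃ F).Λ₂' ∧
        InEndRegime (ne3OfRecord₁₁ F (ne3ConstLayerOfRecord₁₁ F N (ℓ₃ F))) ∧ LeafSlotAT (ne3OfRecord₁₁ F (ne3ConstLayerOfRecord₁₁ F N (ℓ₃ F))) := by
  refine exists_letters_s_N16_readingOfRecord₁₃CoPH_of_edges_allTorus (w1 := w1) (ne2 := ne2) (ne1 := ne1) (hg := hg) (h7 := h7) (h5 := fun F => ?_)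
  obtain ⟨len, C₂, B₀, B₀', cu, cP, B₀β, inp, hlen, hlen1, hB₀, hiB, hB₀', hB, hcu, hcP, hB₀β, hC₂, SP5base, SP5, SH59, SP5u, SB9⟩ := hS F
  obtain ⟨c₁, c₁', B₁', cP', hB₁', hBB, hc₁', hwin, hT, hP⟩ :=
    leafLettersAT_of_socketsPinned (N := N) F.hL.2 1 len inp hB₀ hiB hB₀' hB hcu hcP hB₀β hC₂ SP5base SP5 SH59 SP5u SB9
  exact ⟨len, c₁, c₁', B₁', cP', C₂, B₀β, inp, hlen, hlen1, hB₁', hBB, hc₁', hwin, hT, hP⟩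

end One

/-! ## §2 R-β, `S_N16Holder β` (`0 ≤ β ≤ 1`) at the regime-restricted reading of record, from the five sockets at exponent `β` and N07's linear leaf -/

section Holder

variable {β : ℝ} (hβ0 : 0 ≤ β) (hβ1 : β ≤ 1)
variable (Rg : (F : T4Family) → Stage13HParams F N → Prop)
  (w1 : (F : T4Family) → (θ : Stage13HParams F N) → ReadingData F (MatA N) θ.τ9.M)
  (ne2 : (F : T4Family) → Stage13HParams F N → (ℕ → ℝ) → List (ULoop F) → ℕ → NE2Objects₁₁)
  (ne1 : (F : T4Family) → Stage13HParams F N → (ℕ → ℝ) → List (ULoop F) → NE1pCarriers)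
include hβ0 hβ1

/-- ★ **N16 UNDER R-β AT THE REGIME-RESTRICTED READING OF RECORD FROM THE FIVE SOCKETS AT EXPONENT `β` AND N07's LINEAR LEAF, LETTERS CHOSEN** (`0 ≤ β ≤ 1`): module 37ᴴ's
`exists_letters_s_N16Holder_readingOfRecord₁₃CoPHOn_of_edges_allTorus` with its `h5` supplied by §0 at exponent `β` (Proposition 3's socket `SockB9P3` reads `β` and `len`).
The sockets and `LeafH3sup` are HYPOTHESES; N16 ∕ NE3 NOT discharged. [folklore] -/
theorem exists_letters_s_N16Holder_readingOfRecord₁₃CoPHOn_of_sockets_allTorus {g : T4Family → ℝ} (hg : ∀ F, 0 < g F)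
    (hS : ∀ F : T4Family, letI : CStarAlgebra (Matrix (Fin N) (Fin N) ℂ) := {}
      ∃ (len : Site 4 → ℝ) (C₂ B₀ B₀' cu cP B₀β : ℝ) (inp : B8.B9Inputs),
        (∀ v : Site 4, 0 < len v → 1 ≤ len v) ∧ (∀ μ : Fin 4, len (e μ) = 1) ∧
        0 < B₀ ∧ inp.B₀ ≤ B₀ ∧ 0 < B₀' ∧ 2 ≤ 5 * ((4 : ℕ) : ℝ) * F.L * B₀ ∧ 0 < cu ∧ 0 < cP ∧ 0 ≤ B₀β ∧ 2097152 * (((4 : ℕ) : ℝ) + 1) ^ 2 ≤ C₂ ∧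
        (∀ i : {i : ZdIdx 4 F.L // (∀ j, i.Ω j = Set.univ) ∧ (∀ m j, i.Λs m j = {_y | j = m}) ∧ (∀ m j, i.Λb m j = {_c | j = m}) ∧ i.η = ((F.L : ℝ)⁻¹) ^ i.k}, SockP5base (𝔸 := Matrix (Fin N) (Fin N) ℂ) F.L B₀ B₀' cP i.1.η i.1.k i.1.Ω i.1.Λs) ∧
        (∀ i : {i : ZdIdx 4 F.L // (∀ j, i.Ω j = Set.univ) ∧ (∀ m j, i.Λs m j = {_y | j = m}) ∧ (∀ m j, i.Λb m j = {_c | j = m}) ∧ i.η = ((F.L : ℝ)⁻¹) ^ i.k}, SockP5 (𝔸 := Matrix (Fin N) (Fin N) ℂ) F.L B₀ B₀' cP i.1.η i.1.k i.1.Ω i.1.Λs) ∧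
        (∀ i : {i : ZdIdx 4 F.L // (∀ j, i.Ω j = Set.univ) ∧ (∀ m j, i.Λs m j = {_y | j = m}) ∧ (∀ m j, i.Λb m j = {_c | j = m}) ∧ i.η = ((F.L : ℝ)⁻¹) ^ i.k}, SockH59 (𝔸 := Matrix (Fin N) (Fin N) ℂ) F.L B₀ B₀' cP i.1.η i.1.k i.1.Ω i.1.Λs i.1.Λb) ∧
        (∀ i : {i : ZdIdx 4 F.L // (∀ j, i.Ω j = Set.univ) ∧ (∀ m j, i.Λs m j = {_y | j = m}) ∧ (∀ m j, i.Λb m j = {_c | j = m}) ∧ i.η = ((F.L : ℝ)⁻¹) ^ i.k}, SockP5uE (𝔸 := Matrix (Fin N) (Fin N) ℂ) F.L B₀ cP cu i.1.η i.1.k i.1.Ω i.1.Λs) ∧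
        (∀ i : {i : ZdIdx 4 F.L // (∀ j, i.Ω j = Set.univ) ∧ (∀ m j, i.Λs m j = {_y | j = m}) ∧ (∀ m j, i.Λb m j = {_c | j = m}) ∧ i.η = ((F.L : ℝ)⁻¹) ^ i.k}, SockB9P3 (𝔸 := Matrix (Fin N) (Fin N) ℂ) F.L inp.B₀ B₀β cP β len i.1.η i.1.k i.1.Ω i.1.Λs i.1.Λb))
    (h7 : ∀ F : T4Family, ∃ C ε₀ : ℝ, 0 ≤ C ∧ 0 < ε₀ ∧ ∀ ε : ℝ, 0 < ε → ε ≤ ε₀ →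
      LeafH3sup 4 F.L (ne3NperOfRecord₁₁ F 0 0) ε (C * ε) (C * ε) (ne3DomOfRecord₁₁ F N 0 0)) :
    ∃ ℓ₃ : T4Family → NE3Letters₁₁,
      S_N16Holder β (RRec₁₃CoPHOn (readingOfRecord₁₃CoPH w1 ℓ₃ ne2 ne1) Rg) ∧
      ∀ F : T4Family, (ℓ₃ F).g = g F ∧ (ℓ₃ F).Λ₁ = radiusOfRecordH N F.L (ne3NperOfRecord₁₁ F 0 0) ∧
        (ℓ₃ F).C = constOfRecordH N F.L (ne3NperOfRecord₁₁ F 0 0) (g F) ∧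
        0 < (ℓ₃ F).b ∧ 512 * (4 + 1) * (4 + 4) * (F.L : ℝ) ^ 2 * (ℓ₃ F).b ≤ 1 ∧ 0 < (ℓ₃ F).Λ₂' ∧
        InEndRegimeH (ne3OfRecord₁₁ F (ne3ConstLayerOfRecord₁₁ F N (ℓ₃ F))) ∧ LeafSlotHolderAT (ne3OfRecord₁₁ F (ne3ConstLayerOfRecord₁₁ F N (ℓ₃ F))) β := by
  refine exists_letters_s_N16Holder_readingOfRecord₁₃CoPHOn_of_edges_allTorus hβ0 hβ1 (Rg := Rg) (w1 := w1) (ne2 := ne2) (ne1 := ne1) (hg := hg) (h7 := h7)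
    (h5 := fun F => ?_)
  obtain ⟨len, C₂, B₀, B₀', cu, cP, B₀β, inp, hlen, hlen1, hB₀, hiB, hB₀', hB, hcu, hcP, hB₀β, hC₂, SP5base, SP5, SH59, SP5u, SB9⟩ := hS F
  obtain ⟨c₁, c₁', B₁', cP', hB₁', hBB, hc₁', hwin, hT, hP⟩ :=
    leafLettersAT_of_socketsPinned (N := N) F.hL.2 β len inp hB₀ hiB hB₀' hB hcu hcP hB₀β hC₂ SP5base SP5 SH59 SP5u SB9
  exact ⟨len, c₁, c₁', B₁', cP', C₂, B₀β, inp, hlen, hlen1, hB₁', hBB, hc₁', hwin, hT, hP⟩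

end Holder

/-! ## §3 R-β″, `S_N16HolderMS β` (`0 ≤ β ≤ 1`, MS length letter) at the regime-restricted reading of record, from the five sockets at exponent `β` and N07's linear leaf -/

section MS

variable {β : ℝ} (hβ0 : 0 ≤ β) (hβ1 : β ≤ 1)
variable (Rg : (F : T4Family) → Stage13HParams F N → Prop)
  (w1 : (F : T4Family) → (θ : Stage13HParams F N) → ReadingData F (MatA N) θ.τ9.M)
  (ne2 : (F : T4Family) → Stage13HParams F N → (ℕ → ℝ) → List (ULoop F) → ℕ → NE2Objects₁₁)
  (ne1 : (F : T4Family) → Stage13HParams F N → (ℕ → ℝ) → List (ULoop F) → NE1pCarriers)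
include hβ0 hβ1

/-- ★ **N16 UNDER R-β″ AT THE REGIME-RESTRICTED READING OF RECORD FROM THE FIVE SOCKETS AT EXPONENT `β` (MS LENGTH LETTER) AND N07's LINEAR LEAF, LETTERS CHOSEN** (`0 ≤ β ≤ 1`):
module 37ᴴ's `exists_letters_s_N16HolderMS_readingOfRecord₁₃CoPHOn_of_edges_allTorus` with its `h5` supplied by §0 at exponent `β` (the MS length lines `∀ μ j, len (j • e μ) = j`
ride with `hS`).  The sockets and `LeafH3sup` are HYPOTHESES; N16 ∕ NE3 NOT discharged. [folklore] -/
theorem exists_letters_s_N16HolderMS_readingOfRecord₁₃CoPHOn_of_sockets_allTorus {g : T4Family → ℝ} (hg : ∀ F, 0 < g F)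
    (hS : ∀ F : T4Family, letI : CStarAlgebra (Matrix (Fin N) (Fin N) ℂ) := {}
      ∃ (len : Site 4 → ℝ) (C₂ B₀ B₀' cu cP B₀β : ℝ) (inp : B8.B9Inputs),
        (∀ v : Site 4, 0 < len v → 1 ≤ len v) ∧ (∀ (μ : Fin 4) (j : ℕ), len (j • e μ) = j) ∧
        0 < B₀ ∧ inp.B₀ ≤ B₀ ∧ 0 < B₀' ∧ 2 ≤ 5 * ((4 : ℕ) : ℝ) * F.L * B₀ ∧ 0 < cu ∧ 0 < cP ∧ 0 ≤ B₀β ∧ 2097152 * (((4 : ℕ) : ℝ) + 1) ^ 2 ≤ C₂ ∧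
        (∀ i : {i : ZdIdx 4 F.L // (∀ j, i.Ω j = Set.univ) ∧ (∀ m j, i.Λs m j = {_y | j = m}) ∧ (∀ m j, i.Λb m j = {_c | j = m}) ∧ i.η = ((F.L : ℝ)⁻¹) ^ i.k}, SockP5base (𝔸 := Matrix (Fin N) (Fin N) ℂ) F.L B₀ B₀' cP i.1.η i.1.k i.1.Ω i.1.Λs) ∧
        (∀ i : {i : ZdIdx 4 F.L // (∀ j, i.Ω j = Set.univ) ∧ (∀ m j, i.Λs m j = {_y | j = m}) ∧ (∀ m j, i.Λb m j = {_c | j = m}) ∧ i.η = ((F.L : ℝ)⁻¹) ^ i.k}, SockP5 (𝔸 := Matrix (Fin N) (Fin N) ℂ) F.L B₀ B₀' cP i.1.η i.1.k i.1.Ω i.1.Λs) ∧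
        (∀ i : {i : ZdIdx 4 F.L // (∀ j, i.Ω j = Set.univ) ∧ (∀ m j, i.Λs m j = {_y | j = m}) ∧ (∀ m j, i.Λb m j = {_c | j = m}) ∧ i.η = ((F.L : ℝ)⁻¹) ^ i.k}, SockH59 (𝔸 := Matrix (Fin N) (Fin N) ℂ) F.L B₀ B₀' cP i.1.η i.1.k i.1.Ω i.1.Λs i.1.Λb) ∧
        (∀ i : {i : ZdIdx 4 F.L // (∀ j, i.Ω j = Set.univ) ∧ (∀ m j, i.Λs m j = {_y | j = m}) ∧ (∀ m j, i.Λb m j = {_c | j = m}) ∧ i.η = ((F.L : ℝ)⁻¹) ^ i.k}, SockP5uE (𝔸 := Matrix (Fin N) (Fin N) ℂ) F.L B₀ cP cu i.1.η i.1.k i.1.Ω i.1.Λs) ∧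
        (∀ i : {i : ZdIdx 4 F.L // (∀ j, i.Ω j = Set.univ) ∧ (∀ m j, i.Λs m j = {_y | j = m}) ∧ (∀ m j, i.Λb m j = {_c | j = m}) ∧ i.η = ((F.L : ℝ)⁻¹) ^ i.k}, SockB9P3 (𝔸 := Matrix (Fin N) (Fin N) ℂ) F.L inp.B₀ B₀β cP β len i.1.η i.1.k i.1.Ω i.1.Λs i.1.Λb))
    (h7 : ∀ F : T4Family, ∃ C ε₀ : ℝ, 0 ≤ C ∧ 0 < ε₀ ∧ ∀ ε : ℝ, 0 < ε → ε ≤ ε₀ →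
      LeafH3sup 4 F.L (ne3NperOfRecord₁₁ F 0 0) ε (C * ε) (C * ε) (ne3DomOfRecord₁₁ F N 0 0)) :
    ∃ ℓ₃ : T4Family → NE3Letters₁₁,
      S_N16HolderMS β (RRec₁₃CoPHOn (readingOfRecord₁₃CoPH w1 ℓ₃ ne2 ne1) Rg) ∧
      ∀ F : T4Family, (ℓ₃ F).g = g F ∧ (ℓ₃ F).Λ₁ = radiusOfRecordHMS N F.L (ne3NperOfRecord₁₁ F 0 0) ∧
        (ℓ₃ F).C = constOfRecordHMS N F.L (ne3NperOfRecord₁₁ F 0 0) (g F) ∧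
        0 < (ℓ₃ F).b ∧ 512 * (4 + 1) * (4 + 4) * (F.L : ℝ) ^ 2 * (ℓ₃ F).b ≤ 1 ∧ 0 < (ℓ₃ F).Λ₂' ∧
        InEndRegimeHMS (ne3OfRecord₁₁ F (ne3ConstLayerOfRecord₁₁ F N (ℓ₃ F))) ∧ LeafSlotHolderMSAT (ne3OfRecord₁₁ F (ne3ConstLayerOfRecord₁₁ F N (ℓ₃ F))) β := by
  refine exists_letters_s_N16HolderMS_readingOfRecord₁₃CoPHOn_of_edges_allTorus hβ0 hβ1 (Rg := Rg) (w1 := w1) (ne2 := ne2) (ne1 := ne1) (hg := hg) (h7 := h7)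
    (h5 := fun F => ?_)
  obtain ⟨len, C₂, B₀, B₀', cu, cP, B₀β, inp, hlen, hlenj, hB₀, hiB, hB₀', hB, hcu, hcP, hB₀β, hC₂, SP5base, SP5, SH59, SP5u, SB9⟩ := hS F
  obtain ⟨c₁, c₁', B₁', cP', hB₁', hBB, hc₁', hwin, hT, hP⟩ :=
    leafLettersAT_of_socketsPinned (N := N) F.hL.2 β len inp hB₀ hiB hB₀' hB hcu hcP hB₀β hC₂ SP5base SP5 SH59 SP5u SB9
  exact ⟨len, c₁, c₁', B₁', cP', C₂, B₀β, inp, hlen, hlenj, hB₁', hBB, hc₁', hwin, hT, hP⟩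

end MS

end

end Summit.QuantumFields.YangMills.BalabanUVNodes.N16OfSocketsAllTorusAtRecord13CoPH
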